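import Mathlib

/-!
# Joint continuity of evaluation under coefficientwise convergence with bounded degree

Stub `stub_tendsto_eval_of_tendsto_coeff` for the line `Sketch_ideator4` of the crux
`RefutationBarrier`: if `f k → g` coefficientwise, every `f k` has total degree `≤ d`, and
`x k → x₀`, then `eval (x k) (f k) → eval x₀ g`.  The point is that all the `f k` (and hence
`g`) are supported on the finite set of exponents of degree `≤ d`, so evaluation is a fixed
finite sum of products of convergent sequences.
-/

set_option linter.dupNamespace false

noncomputable section

open Filter Topology MvPolynomial

namespace Summit.ValiantsHypothesis.ValiantsHypothesis.Theorems.RefutationDegree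

/-- Evaluation of a polynomial whose coefficients vanish off a finite set `S` of exponents is
the `S`-indexed sum of the monomial evaluations. -/
private theorem eval_eq_sum_of_coeff_eq_zero {σ : Type*} [Fintype σ] (S : Finset (σ →₀ ℕ))
    (p : MvPolynomial σ ℂ) (hp : ∀ μ ∉ S, p.coeff μ = 0) (y : σ → ℂ) :
    eval y p = ∑ μ ∈ S, p.coeff μ * ∏ i, y i ^ μ i := by
  rw [eval_eq']
  refine Finset.sum_subset (fun μ hμ => ?_) (fun μ _ hμ => ?_)
  · by_contra h
    exact (mem_support_iff.mp hμ) (hp μ h)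
  · rw [notMem_support_iff.mp hμ, zero_mul]

/-- If `f k → g` coefficientwise, all `f k` have total degree at most `d`, and `x k → x₀`,
then `eval (x k) (f k) → eval x₀ g`. -/
theorem stub_tendsto_eval_of_tendsto_coeff {σ : Type*} [Fintype σ] {d : ℕ}
    (f : ℕ → MvPolynomial σ ℂ) (g : MvPolynomial σ ℂ) (hf : ∀ k, (f k).totalDegree ≤ d)
    (hcoeff : ∀ μ : σ →₀ ℕ, Tendsto (fun k => (f k).coeff μ) atTop (𝓝 (g.coeff μ)))
    (x : ℕ → σ → ℂ) (x₀ : σ → ℂ) (hx : Tendsto x atTop (𝓝 x₀)) :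
    Tendsto (fun k => eval (x k) (f k)) atTop (𝓝 (eval x₀ g)) := by
  -- the finite set of exponents of degree `≤ d`
  obtain ⟨S, hS⟩ : ∃ S : Finset (σ →₀ ℕ), ∀ μ : σ →₀ ℕ, μ ∉ S → d < μ.degree :=
    ⟨(Finsupp.finite_of_degree_le d).toFinset, fun _ hμ =>
      not_le.mp fun h => hμ ((Finsupp.finite_of_degree_le d).mem_toFinset.mpr h)⟩
  -- every `f k` is supported on `S`
  have hf0 : ∀ k, ∀ μ ∉ S, (f k).coeff μ = 0 := fun k μ hμ => by
    have hlt := (hf k).trans_lt (hS μ hμ)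
    rw [Finsupp.degree_apply] at hlt
    exact coeff_eq_zero_of_totalDegree_lt hlt
  -- hence so is the coefficientwise limit `g`
  have hg0 : ∀ μ ∉ S, g.coeff μ = 0 := fun μ hμ => by
    have h0 : Tendsto (fun k => (f k).coeff μ) atTop (𝓝 0) := by
      have : (fun k => (f k).coeff μ) = fun _ => (0 : ℂ) := funext fun k => hf0 k μ hμ
      rw [this]
      exact tendsto_const_nhds
    exact tendsto_nhds_unique (hcoeff μ) h0
  have h1 : (fun k => eval (x k) (f k)) =
      fun k => ∑ μ ∈ S, (f k).coeff μ * ∏ i, x k i ^ μ i := by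
    funext k
    exact eval_eq_sum_of_coeff_eq_zero S (f k) (hf0 k) (x k)
  rw [h1, eval_eq_sum_of_coeff_eq_zero S g hg0 x₀]
  refine tendsto_finsetSum S fun μ _ => (hcoeff μ).mul (tendsto_finsetProd _ fun i _ => ?_)
  exact (tendsto_pi_nhds.1 hx i).pow (μ i)

end Summit.ValiantsHypothesis.ValiantsHypothesis.Theorems.RefutationDegree

end
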